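import Literature.MathematicalPhysics.QuantumLattice.MatsubaraDeterminantBound
import Literature.MathematicalPhysics.QuantumLattice.ChronologicalGramBoundTimes
import HarnessLib

/-!
# The chronological determinant bound with free rows (mixed Gram–Hadamard form)

Topic `MathematicalPhysics/QuantumLattice`; companion of `ChronologicalGramBoundTimes.lean` and
`MatsubaraDeterminantBound.lean` (de Siqueira Pedra–Salmhofer 2008, Thm 1.3 / Lemma 3.9 / Thm 2.4).
In determinant expansions one meets matrices some of whose rows are chronological two-kernel rows
(`τ'_b ≤ τ_a ? ⟨u_a, v_b⟩ : ⟨p_a, q_b⟩`) while the remaining rows `a ∈ E` are ARBITRARY vectors `ρ_a`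
(remainder rows of a perturbed covariance). Such a matrix still obeys an `n!`-free bound, in which
every free row enters only through its `ℓ²` norm `‖ρ_a‖₂` (Hadamard) and every chronological row
through its Gram data:

* **`norm_det_chronological_freeRows_le_of_times'`** —
  `|det| ≤ ∏_a (a ∈ E ? √(2‖ρ_a‖₂²) : √(‖u_a‖²+‖p_a‖²)) · ∏_b √(‖v_b‖²+‖q_b‖²+2)`.
  PROOF: augment the coordinate spaces by a block `Fin n`; chronological rows become `(u_a, 0)`,
  `(p_a, 0)`, free rows `(0, ρ_a)` in BOTH kernels, columns `(v_b, e_b)`, `(q_b, e_b)`; both branches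
  of the pattern then read `ρ_a(b)` on the free rows, and `norm_det_chronological_le_of_times'`
  applies verbatim. No Laplace expansion, no Cauchy–Binet.
* **`norm_det_timeOrdered_modes_freeRows_le`** — the many-fermion instance (mode form of
  `norm_det_timeOrdered_modes_le`, real times `s_a, t_b ∈ [0, β]`, NON-STRICT pattern `t_b ≤ s_a`,
  no sorting hypotheses): `|det| ≤ 2ⁿ ∏_{a∉E} ‖F_a‖₂ ∏_{a∈E} ‖ρ_a‖₂ ∏_b √(‖G_b‖₂²+1)`.

Everything is PROVED; no definition. Used by the all-coupling Matsubara-UV limit of the Hubbard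
Grassmann representation (remainder rows = truncated minus untruncated propagator).

## References

* W. de Siqueira Pedra, M. Salmhofer, Comm. Math. Phys. 282 (2008) 797–818, Thm 1.3, Lemma 3.9,
  Thm 2.4, Lemma 4.1. [PedraSalmhofer2008]
-/

noncomputable section

open scoped Matrix ComplexOrder
open Finset NormedSpace Literature.Analysis.Matrix

namespace Literature.MathematicalPhysics.QuantumLattice

variable {ι₁ ι₂ : Type*} [Fintype ι₁] [Fintype ι₂]

/-- Pairing a vector against a standard basis vector: `Σ_c ρ(c) · e_b(c) = ρ(b)`. [folklore] -/
private theorem sum_mul_pi_single_one {n : ℕ} (ρ : Fin n → ℂ) (b : Fin n) :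
    ∑ c, ρ c * (Pi.single b (1 : ℂ) : Fin n → ℂ) c = ρ b := by
  classical
  simp only [Pi.single_apply, mul_ite, mul_one, mul_zero, Finset.sum_ite_eq', Finset.mem_univ,
    if_true]

/-- The squared `ℓ²` norm of a standard basis vector is `1`. [folklore] -/
private theorem sum_norm_pi_single_one_sq {n : ℕ} (b : Fin n) :
    ∑ c, ‖(Pi.single b (1 : ℂ) : Fin n → ℂ) c‖ ^ 2 = 1 := by
  classical
  simp only [Pi.single_apply, apply_ite norm, norm_one, norm_zero, ite_pow, one_pow,
    zero_pow two_ne_zero, Finset.sum_ite_eq', Finset.mem_univ, if_true]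

/-- **The chronological determinant bound with free rows** (mixed Gram–Hadamard form of
de Siqueira Pedra–Salmhofer 2008, Lemma 3.9 / Thm 1.3). Rows with times `τ_a`, columns with times
`τ'_b` in a linear order `J`; chronological rows `a ∉ E` carry Gram data `u_a, p_a` (kernels
`τ'_b ≤ τ_a ? Σ u_a v_b : Σ p_a q_b`), free rows `a ∈ E` are arbitrary vectors `ρ_a`. Then
`|det| ≤ ∏_a (a ∈ E ? √(2 Σ_b ‖ρ_a b‖²) : √(‖u_a‖²+‖p_a‖²)) · ∏_b √(‖v_b‖²+‖q_b‖²+2)` — the free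
rows enter through their `ℓ²` norms only, no `n!`. Proof: augment the coordinates by a block
`Fin n` (free rows `(0, ρ_a)`, columns `(v_b, e_b)`, `(q_b, e_b)`) and apply
`norm_det_chronological_le_of_times'`. [cite: PedraSalmhofer2008, Lemma 3.9] -/
theorem norm_det_chronological_freeRows_le_of_times' {J : Type*} [LinearOrder J] {n : ℕ}
    (τ τ' : Fin n → J) (u v : Fin n → ι₁ → ℂ) (p q : Fin n → ι₂ → ℂ)
    (E : Finset (Fin n)) (ρ : Fin n → Fin n → ℂ) :
    ‖(Matrix.of fun a b : Fin n =>
        if a ∈ E then ρ a b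
        else if τ' b ≤ τ a then ∑ i, u a i * v b i else ∑ j, p a j * q b j).det‖ ≤
      (∏ a, if a ∈ E then Real.sqrt (2 * ∑ b, ‖ρ a b‖ ^ 2)
        else Real.sqrt (∑ i, ‖u a i‖ ^ 2 + ∑ j, ‖p a j‖ ^ 2)) *
        ∏ b, Real.sqrt (∑ i, ‖v b i‖ ^ 2 + ∑ j, ‖q b j‖ ^ 2 + 2) := by
  classical
  -- augmented coordinates
  set u' : Fin n → (ι₁ ⊕ Fin n) → ℂ :=
    fun a => if a ∈ E then Sum.elim 0 (ρ a) else Sum.elim (u a) 0 with hu'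
  set p' : Fin n → (ι₂ ⊕ Fin n) → ℂ :=
    fun a => if a ∈ E then Sum.elim 0 (ρ a) else Sum.elim (p a) 0 with hp'
  set v' : Fin n → (ι₁ ⊕ Fin n) → ℂ := fun b => Sum.elim (v b) (Pi.single b 1) with hv'
  set q' : Fin n → (ι₂ ⊕ Fin n) → ℂ := fun b => Sum.elim (q b) (Pi.single b 1) with hq'
  -- the entries of the augmented chronological matrix
  have h1 : ∀ a b, ∑ x, u' a x * v' b x = if a ∈ E then ρ a b else ∑ i, u a i * v b i := by
    intro a b
    rw [Fintype.sum_sum_type]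
    by_cases ha : a ∈ E
    · simp only [hu', hv', ha, if_true, Sum.elim_inl, Sum.elim_inr, Pi.zero_apply, zero_mul,
        Finset.sum_const_zero, zero_add, sum_mul_pi_single_one]
    · simp only [hu', hv', ha, if_false, Sum.elim_inl, Sum.elim_inr, Pi.zero_apply, zero_mul,
        Finset.sum_const_zero, add_zero]
  have h2 : ∀ a b, ∑ x, p' a x * q' b x = if a ∈ E then ρ a b else ∑ j, p a j * q b j := by
    intro a b
    rw [Fintype.sum_sum_type]
    by_cases ha : a ∈ E
    · simp only [hp', hq', ha, if_true, Sum.elim_inl, Sum.elim_inr, Pi.zero_apply, zero_mul,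
        Finset.sum_const_zero, zero_add, sum_mul_pi_single_one]
    · simp only [hp', hq', ha, if_false, Sum.elim_inl, Sum.elim_inr, Pi.zero_apply, zero_mul,
        Finset.sum_const_zero, add_zero]
  have hM : (Matrix.of fun a b : Fin n =>
        if a ∈ E then ρ a b
        else if τ' b ≤ τ a then ∑ i, u a i * v b i else ∑ j, p a j * q b j) =
      Matrix.of fun a b : Fin n =>
        if τ' b ≤ τ a then ∑ x, u' a x * v' b x else ∑ x, p' a x * q' b x := by
    ext a b
    simp only [Matrix.of_apply, h1, h2]
    by_cases ha : a ∈ E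
    · simp only [ha, if_true, ite_self]
    · simp only [ha, if_false]
  -- the norms of the augmented coordinates
  have hrow : ∀ a, ∑ x, ‖u' a x‖ ^ 2 + ∑ x, ‖p' a x‖ ^ 2 =
      if a ∈ E then 2 * ∑ b, ‖ρ a b‖ ^ 2 else ∑ i, ‖u a i‖ ^ 2 + ∑ j, ‖p a j‖ ^ 2 := by
    intro a
    rw [Fintype.sum_sum_type, Fintype.sum_sum_type]
    by_cases ha : a ∈ E
    · simp only [hu', hp', ha, if_true, Sum.elim_inl, Sum.elim_inr, Pi.zero_apply, norm_zero,
        zero_pow two_ne_zero, Finset.sum_const_zero, zero_add]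
      ring
    · simp only [hu', hp', ha, if_false, Sum.elim_inl, Sum.elim_inr, Pi.zero_apply, norm_zero,
        zero_pow two_ne_zero, Finset.sum_const_zero, add_zero]
  have hcol : ∀ b, ∑ x, ‖v' b x‖ ^ 2 + ∑ x, ‖q' b x‖ ^ 2 =
      ∑ i, ‖v b i‖ ^ 2 + ∑ j, ‖q b j‖ ^ 2 + 2 := by
    intro b
    rw [Fintype.sum_sum_type, Fintype.sum_sum_type]
    simp only [hv', hq', Sum.elim_inl, Sum.elim_inr, sum_norm_pi_single_one_sq]
    ring
  rw [hM]
  refine (norm_det_chronological_le_of_times' τ τ' u' v' p' q').trans (le_of_eq ?_)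
  congr 1
  · refine Finset.prod_congr rfl fun a _ => ?_
    rw [hrow a]
    split_ifs <;> rfl
  · exact Finset.prod_congr rfl fun b _ => by rw [hcol b]

/-- **Pedra–Salmhofer's determinant bound for the time-ordered free propagator with free rows**
(mode form of de Siqueira Pedra–Salmhofer 2008, Thm 2.4 / Lemma 4.1, mixed Gram–Hadamard version).
One-body modes `m` with real energies `d_m`, inverse temperature `β`, creation data
(`F_a`, `s_a ∈ [0,β]`), annihilation data (`G_b`, `t_b ∈ [0,β]`), the NON-STRICT chronological
pattern `t_b ≤ s_a` (creation left of annihilation, ties included), and a set `E` of free rows with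
arbitrary entries `ρ_a(b)`. The matrix
`a ∈ E ? ρ_a(b) : (t_b ≤ s_a ? Σ_m F_a(m)G_b(m) e^{(s_a-t_b)d_m}/(1+e^{βd_m}) : -Σ_m F_a(m)G_b(m) e^{(s_a-t_b)d_m}/(1+e^{-βd_m}))`
satisfies `|det| ≤ 2ⁿ · ∏_a (a ∈ E ? ‖ρ_a‖₂ : ‖F_a‖₂) · ∏_b √(‖G_b‖₂² + 1)` — uniformly in `β`, the
energies and the number of modes, no `n!`. Proof: the unit Gram vectors of the time kernels
(`timeKernel_on_eq`, `timeKernel_off_eq`, `IsPosDefKernel.exists_gram_vectors`) as in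
`norm_det_timeOrdered_modes_le`, then `norm_det_chronological_freeRows_le_of_times'`.
[cite: PedraSalmhofer2008, Thm 2.4 and Lemma 4.1] -/
theorem norm_det_timeOrdered_modes_freeRows_le {μ : Type*} [Fintype μ] (d : μ → ℝ) (β : ℝ)
    {n : ℕ} (F G : Fin n → μ → ℂ) (s t : Fin n → ℝ)
    (hs : ∀ a, 0 ≤ s a ∧ s a ≤ β) (ht : ∀ b, 0 ≤ t b ∧ t b ≤ β)
    (E : Finset (Fin n)) (ρ : Fin n → Fin n → ℂ) :
    ‖(Matrix.of fun a b : Fin n =>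
        if a ∈ E then ρ a b
        else if t b ≤ s a then
          ∑ m, F a m * G b m *
            ((Real.exp ((s a - t b) * d m) * (1 + Real.exp (β * d m))⁻¹ : ℝ) : ℂ)
        else -∑ m, F a m * G b m *
            ((Real.exp ((s a - t b) * d m) * (1 + Real.exp (-(β * d m)))⁻¹ : ℝ) : ℂ)).det‖ ≤
      2 ^ n * ((∏ a, if a ∈ E then Real.sqrt (∑ b, ‖ρ a b‖ ^ 2)
          else Real.sqrt (∑ m, ‖F a m‖ ^ 2)) *
        ∏ b, Real.sqrt (∑ m, ‖G b m‖ ^ 2 + 1)) := by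
  classical
  -- weights
  set w : μ → ℝ := fun m => (1 + Real.exp (-(β * |d m|)))⁻¹ with hw
  have hw0 : ∀ m, 0 ≤ w m := fun m => by positivity
  have hw1 : ∀ m, w m ≤ 1 := fun m => by
    simp only [hw]
    apply inv_le_one_of_one_le₀
    linarith [Real.exp_pos (-(β * |d m|))]
  have hsqw : ∀ m, ((Real.sqrt (w m) : ℝ) : ℂ) * (Real.sqrt (w m) : ℂ) = (w m : ℂ) := fun m => by
    rw [← Complex.ofReal_mul, Real.mul_self_sqrt (hw0 m)]
  -- clocks
  set z₁ : μ → (Fin n ⊕ Fin n) → ℝ :=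
    fun m => Sum.elim (fun a => s a - if 0 < d m then β else 0) t with hz₁
  set z₂ : μ → (Fin n ⊕ Fin n) → ℝ :=
    fun m => Sum.elim s (fun b => t b - if d m < 0 then β else 0) with hz₂
  -- unit Gram vectors of the time kernels, mode by mode
  have hV : ∀ (m : μ) (z : (Fin n ⊕ Fin n) → ℝ), ∃ V : (Fin n ⊕ Fin n) → (Fin n ⊕ Fin n) → ℂ,
      (∀ a b, ∑ r, star (V a r) * V b r = (Real.exp (-(|d m| * |z a - z b|)) : ℂ)) ∧
        ∀ a, ∑ r, ‖V a r‖ ^ 2 = 1 := fun m z =>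
    (isPosDefKernel_exp_neg_mul_abs_sub (abs_nonneg (d m))).exists_gram_vectors
      (fun y => by simp) z
  choose V₁ hV₁ hV₁n using fun m => hV m (z₁ m)
  choose V₂ hV₂ hV₂n using fun m => hV m (z₂ m)
  -- coordinates
  set u : Fin n → (μ × (Fin n ⊕ Fin n)) → ℂ :=
    fun a x => F a x.1 * (Real.sqrt (w x.1) : ℂ) * star (V₁ x.1 (Sum.inl a) x.2) with hu
  set v : Fin n → (μ × (Fin n ⊕ Fin n)) → ℂ :=
    fun b x => G b x.1 * (Real.sqrt (w x.1) : ℂ) * V₁ x.1 (Sum.inr b) x.2 with hv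
  set p : Fin n → (μ × (Fin n ⊕ Fin n)) → ℂ :=
    fun a x => F a x.1 * (Real.sqrt (w x.1) : ℂ) * star (V₂ x.1 (Sum.inl a) x.2) with hp
  set q : Fin n → (μ × (Fin n ⊕ Fin n)) → ℂ :=
    fun b x => -(G b x.1 * (Real.sqrt (w x.1) : ℂ) * V₂ x.1 (Sum.inr b) x.2) with hq
  -- the entries ON the pattern (`t b ≤ s a`)
  have hon : ∀ a b : Fin n, t b ≤ s a → ∑ x, u a x * v b x =
      ∑ m, F a m * G b m *
        ((Real.exp ((s a - t b) * d m) * (1 + Real.exp (β * d m))⁻¹ : ℝ) : ℂ) := by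
    intro a b htsa
    rw [Fintype.sum_prod_type]
    refine Finset.sum_congr rfl fun m _ => ?_
    have e1 : ∀ r, u a (m, r) * v b (m, r) = F a m * G b m * (w m : ℂ) *
        (star (V₁ m (Sum.inl a) r) * V₁ m (Sum.inr b) r) := by
      intro r
      simp only [hu, hv]
      rw [← hsqw m]
      ring
    simp_rw [e1]
    rw [← Finset.mul_sum, hV₁ m, timeKernel_on_eq (d m) β (s a) (t b) htsa (hs a).2 (ht b).1]
    simp only [hz₁, Sum.elim_inl, Sum.elim_inr, hw]
    push_cast
    ring_nf
  -- the entries OFF the pattern (`s a < t b`)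
  have hoff : ∀ a b : Fin n, ¬ t b ≤ s a → ∑ x, p a x * q b x =
      -∑ m, F a m * G b m *
        ((Real.exp ((s a - t b) * d m) * (1 + Real.exp (-(β * d m)))⁻¹ : ℝ) : ℂ) := by
    intro a b hab
    have hsat : s a ≤ t b := (not_le.mp hab).le
    rw [Fintype.sum_prod_type, ← Finset.sum_neg_distrib]
    refine Finset.sum_congr rfl fun m _ => ?_
    have e1 : ∀ r, p a (m, r) * q b (m, r) = -(F a m * G b m * (w m : ℂ) *
        (star (V₂ m (Sum.inl a) r) * V₂ m (Sum.inr b) r)) := by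
      intro r
      simp only [hp, hq]
      rw [← hsqw m]
      ring
    simp_rw [e1]
    rw [Finset.sum_neg_distrib, ← Finset.mul_sum, hV₂ m,
      timeKernel_off_eq (d m) β (s a) (t b) hsat (hs a).1 (ht b).2]
    simp only [hz₂, Sum.elim_inl, Sum.elim_inr, hw]
    push_cast
    ring_nf
  -- the realisation
  have hM : (Matrix.of fun a b : Fin n =>
        if a ∈ E then ρ a b
        else if t b ≤ s a then
          ∑ m, F a m * G b m *
            ((Real.exp ((s a - t b) * d m) * (1 + Real.exp (β * d m))⁻¹ : ℝ) : ℂ)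
        else -∑ m, F a m * G b m *
            ((Real.exp ((s a - t b) * d m) * (1 + Real.exp (-(β * d m)))⁻¹ : ℝ) : ℂ)) =
      Matrix.of fun a b : Fin n =>
        if a ∈ E then ρ a b
        else if t b ≤ s a then ∑ x, u a x * v b x else ∑ x, p a x * q b x := by
    ext a b
    simp only [Matrix.of_apply]
    split_ifs with hE hab
    · rfl
    · rw [hon a b hab]
    · rw [hoff a b hab]
  rw [hM]
  refine (norm_det_chronological_freeRows_le_of_times' s t u v p q E ρ).trans ?_
  -- norms of the coordinates
  have hnu : ∀ a, ∑ x, ‖u a x‖ ^ 2 ≤ ∑ m, ‖F a m‖ ^ 2 := by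
    intro a
    rw [Fintype.sum_prod_type]
    refine Finset.sum_le_sum fun m _ => ?_
    have e1 : ∀ r, ‖u a (m, r)‖ ^ 2 = ‖F a m‖ ^ 2 * w m * ‖V₁ m (Sum.inl a) r‖ ^ 2 := by
      intro r
      simp only [hu, norm_mul, norm_star, Complex.norm_real, Real.norm_eq_abs,
        abs_of_nonneg (Real.sqrt_nonneg _), mul_pow, Real.sq_sqrt (hw0 m)]
    simp_rw [e1]
    rw [← Finset.mul_sum, hV₁n m, mul_one]
    exact mul_le_of_le_one_right (by positivity) (hw1 m)
  have hnp : ∀ a, ∑ x, ‖p a x‖ ^ 2 ≤ ∑ m, ‖F a m‖ ^ 2 := by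
    intro a
    rw [Fintype.sum_prod_type]
    refine Finset.sum_le_sum fun m _ => ?_
    have e1 : ∀ r, ‖p a (m, r)‖ ^ 2 = ‖F a m‖ ^ 2 * w m * ‖V₂ m (Sum.inl a) r‖ ^ 2 := by
      intro r
      simp only [hp, norm_mul, norm_star, Complex.norm_real, Real.norm_eq_abs,
        abs_of_nonneg (Real.sqrt_nonneg _), mul_pow, Real.sq_sqrt (hw0 m)]
    simp_rw [e1]
    rw [← Finset.mul_sum, hV₂n m, mul_one]
    exact mul_le_of_le_one_right (by positivity) (hw1 m)
  have hnv : ∀ b, ∑ x, ‖v b x‖ ^ 2 ≤ ∑ m, ‖G b m‖ ^ 2 := by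
    intro b
    rw [Fintype.sum_prod_type]
    refine Finset.sum_le_sum fun m _ => ?_
    have e1 : ∀ r, ‖v b (m, r)‖ ^ 2 = ‖G b m‖ ^ 2 * w m * ‖V₁ m (Sum.inr b) r‖ ^ 2 := by
      intro r
      simp only [hv, norm_mul, Complex.norm_real, Real.norm_eq_abs,
        abs_of_nonneg (Real.sqrt_nonneg _), mul_pow, Real.sq_sqrt (hw0 m)]
    simp_rw [e1]
    rw [← Finset.mul_sum, hV₁n m, mul_one]
    exact mul_le_of_le_one_right (by positivity) (hw1 m)
  have hnq : ∀ b, ∑ x, ‖q b x‖ ^ 2 ≤ ∑ m, ‖G b m‖ ^ 2 := by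
    intro b
    rw [Fintype.sum_prod_type]
    refine Finset.sum_le_sum fun m _ => ?_
    have e1 : ∀ r, ‖q b (m, r)‖ ^ 2 = ‖G b m‖ ^ 2 * w m * ‖V₂ m (Sum.inr b) r‖ ^ 2 := by
      intro r
      simp only [hq, norm_neg, norm_mul, Complex.norm_real, Real.norm_eq_abs,
        abs_of_nonneg (Real.sqrt_nonneg _), mul_pow, Real.sq_sqrt (hw0 m)]
    simp_rw [e1]
    rw [← Finset.mul_sum, hV₂n m, mul_one]
    exact mul_le_of_le_one_right (by positivity) (hw1 m)
  -- assemble: rows `≤ √2 · (‖ρ_a‖ or ‖F_a‖)`, columns `≤ √2 · √(‖G_b‖² + 1)`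
  have hrow : (∏ a, if a ∈ E then Real.sqrt (2 * ∑ b, ‖ρ a b‖ ^ 2)
        else Real.sqrt (∑ x, ‖u a x‖ ^ 2 + ∑ x, ‖p a x‖ ^ 2)) ≤
      (Real.sqrt 2) ^ n * ∏ a, (if a ∈ E then Real.sqrt (∑ b, ‖ρ a b‖ ^ 2)
        else Real.sqrt (∑ m, ‖F a m‖ ^ 2)) := by
    have : (Real.sqrt 2) ^ n * ∏ a, (if a ∈ E then Real.sqrt (∑ b, ‖ρ a b‖ ^ 2)
        else Real.sqrt (∑ m, ‖F a m‖ ^ 2)) =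
        ∏ a : Fin n, (Real.sqrt 2 * (if a ∈ E then Real.sqrt (∑ b, ‖ρ a b‖ ^ 2)
          else Real.sqrt (∑ m, ‖F a m‖ ^ 2))) := by
      rw [Finset.prod_mul_distrib, Finset.prod_const, Finset.card_univ, Fintype.card_fin]
    rw [this]
    refine Finset.prod_le_prod (fun a _ => ?_) fun a _ => ?_
    · split_ifs <;> exact Real.sqrt_nonneg _
    · split_ifs with ha
      · rw [← Real.sqrt_mul (by norm_num : (0 : ℝ) ≤ 2)]
      · rw [← Real.sqrt_mul (by norm_num : (0 : ℝ) ≤ 2)]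
        exact Real.sqrt_le_sqrt (by linarith [hnu a, hnp a])
  have hcol : (∏ b, Real.sqrt (∑ x, ‖v b x‖ ^ 2 + ∑ x, ‖q b x‖ ^ 2 + 2)) ≤
      (Real.sqrt 2) ^ n * ∏ b, Real.sqrt (∑ m, ‖G b m‖ ^ 2 + 1) := by
    have : (Real.sqrt 2) ^ n * ∏ b, Real.sqrt (∑ m, ‖G b m‖ ^ 2 + 1) =
        ∏ b : Fin n, (Real.sqrt 2 * Real.sqrt (∑ m, ‖G b m‖ ^ 2 + 1)) := by
      rw [Finset.prod_mul_distrib, Finset.prod_const, Finset.card_univ, Fintype.card_fin]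
    rw [this]
    refine Finset.prod_le_prod (fun b _ => Real.sqrt_nonneg _) fun b _ => ?_
    rw [← Real.sqrt_mul (by norm_num : (0 : ℝ) ≤ 2)]
    exact Real.sqrt_le_sqrt (by linarith [hnv b, hnq b])
  have h2n : (Real.sqrt 2) ^ n * (Real.sqrt 2) ^ n = 2 ^ n := by
    rw [← mul_pow, Real.mul_self_sqrt (by norm_num : (0 : ℝ) ≤ 2)]
  have hR0 : 0 ≤ (Real.sqrt 2) ^ n * ∏ a, (if a ∈ E then Real.sqrt (∑ b, ‖ρ a b‖ ^ 2)
      else Real.sqrt (∑ m, ‖F a m‖ ^ 2)) :=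
    mul_nonneg (by positivity) (Finset.prod_nonneg fun a _ => by
      split_ifs <;> exact Real.sqrt_nonneg _)
  have hcol0 : 0 ≤ ∏ b, Real.sqrt (∑ x, ‖v b x‖ ^ 2 + ∑ x, ‖q b x‖ ^ 2 + 2) :=
    Finset.prod_nonneg fun b _ => Real.sqrt_nonneg _
  calc (∏ a, if a ∈ E then Real.sqrt (2 * ∑ b, ‖ρ a b‖ ^ 2)
          else Real.sqrt (∑ x, ‖u a x‖ ^ 2 + ∑ x, ‖p a x‖ ^ 2)) *
        ∏ b, Real.sqrt (∑ x, ‖v b x‖ ^ 2 + ∑ x, ‖q b x‖ ^ 2 + 2)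
      ≤ ((Real.sqrt 2) ^ n * ∏ a, (if a ∈ E then Real.sqrt (∑ b, ‖ρ a b‖ ^ 2)
          else Real.sqrt (∑ m, ‖F a m‖ ^ 2))) *
          ((Real.sqrt 2) ^ n * ∏ b, Real.sqrt (∑ m, ‖G b m‖ ^ 2 + 1)) :=
        mul_le_mul hrow hcol hcol0 hR0
    _ = 2 ^ n * ((∏ a, if a ∈ E then Real.sqrt (∑ b, ‖ρ a b‖ ^ 2)
          else Real.sqrt (∑ m, ‖F a m‖ ^ 2)) *
        ∏ b, Real.sqrt (∑ m, ‖G b m‖ ^ 2 + 1)) := by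
        rw [← h2n]; ring

end Literature.MathematicalPhysics.QuantumLattice
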